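import Literature.Probability.Percolation.MarkedLoopLawContract
import Literature.Probability.Percolation.MarkedLoopPendantRootless
import Literature.Probability.Percolation.TriMarkedRingLocal
import HarnessLib

/-!
# Two adjacent hexagons attached along the boundary, one disorder on each: the ring geometry, the two-mark datum and the parity walk («TWO-CELL-RING»)

Topic `Literature/Probability/Percolation`; generic-`k` layer of the marked-loop (Khristoforov–Smirnov) lineage; the geometric half of the lane's TWO-CELL CAP IDENTITY
(HOME `FINDING-TWO-CELL-CAP-IDENTITY.md` §2, the Bollobás–Riordan-representable replacement of the one-hexagon cap surgery F1):
`law(Ω ∪ h₁ ∪ h₂; M̂ + a + b) = cap_{a,b} law(Ω; M̂) + law(Ω; M̂ + P + Q) + law(Ω; M̂ + P + c) + law(Ω; M̂ + c + Q)`.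
This file is the two-cell analogue of the ring sections of `MarkedLoopLawSlide.lean` (#848, ONE hexagon: `nbond`, `side_N_idx*`, `odd_xiDeg_iff_not_iff`, the one-flip parity walk)
and `MarkedLoopLawAttachSplit.lean` / `MarkedLoopLawContract.lean` (`AttachData`, `EN h r m`, `odd_xiDeg_EN_iff`, `EN_reachable`, `EN_faces`).

SETTING (`TwoCellData`). `D = (Ω; M̂)` is a `k`-marked domain on the sites `G`; `W = (Ω ∪ h₁ ∪ h₂; M̂ + a + b)` is a `k+2`-marked domain on `G' = G ∪ {h₁, h₂}`, `h₁, h₂ ∉ G`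
adjacent. In the ring coordinates of `h₁` (directions `triDir (r₁ + k)`) the cells at offsets `k ≤ m₁` are OUTSIDE `G'`, the cell at offset `m₁ + 1` is `h₂`, those at offsets
`k ≥ m₁ + 2` are in `G` (`m₁ ≤ 3`); in the ring coordinates of `h₂` (base `r₂ = r₁ + m₁ + 5`, so that `h₂ + e_{r₂} = h₁ + e_{r₁ + m₁}` is the last outer cell of `h₁`) the cells at
offsets `k ≤ m₂` are outside `G'`, those at offsets `m₂ < k ≤ 4` in `G`, and the cell at offset `5` is `h₁`. Faces (`N¹_k = leftFaceDir h₁ (r₁ + k)`, `N²_k = leftFaceDir h₂ (r₂ + k)`):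
the first contact end `P = N¹_5`, the outer faces `N¹_k`, `k < m₁`, of `h₁`, the OUTER JUNCTION `J = N¹_{m₁} = N²_5 = {h₁, h₂, o}`, the outer faces `N²_k`, `k < m₂`, of `h₂`, the
last contact end `Q = N²_{m₂}`, and the INNER JUNCTION `c = N¹_{m₁+1} = N²_4 = {h₁, h₂, s}` (`s ∈ G`). The NEW bonds of `H_{G'}` are `nb¹_k = nbond h₁ (r₁ + k)`, `k ≤ m₁ + 1`
(`nb¹_{m₁+1} = {h₁, h₂} =: I`, the interior bond) and `nb²_k = nbond h₂ (r₂ + k)`, `k ≤ m₂`. The marks of `W`: the corners of `D` relabelled by `skip j`, and the two new corners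
`a = N¹_{k₁}` (`k₁ < m₁`) and `b = N²_{k₂}` (`k₂ < m₂`) at the adjacent indices `{ja, jb} = {j, j+1}`.

* §1 (`D`-free): `nbond_mem_iff_of_step` (the one-flip walk as pure `Fin 6` bookkeeping), `odd_xiDeg_EQ_iff` / `EQ_reachable` / `EQ_faces` (the half path `EQ` of #848, `D`-free),
  the two-hexagon identities `leftFaceDir_add_triDir_add_three`, `add_triDir_mem_hexFaceVertices_N_iff`, `mem_hexFaceVertices_N_add_triDir_iff`, `nbond_eq_nbond_add_triDir_iff`;
* §2 `TwoCellData` and its plumbing: `h₁_eq` / `o_eq` / `J_eq` / `c_eq` / `I_eq` (the junction identities), `IsNew`, ★ `mem_hBondsW_iff` (`H_{G'} = H_G ⊔ new`), `new_not_mem_hBonds`,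
  ★ `mem_touchingW_iff`, `N¹_not_touching` / `N²_not_touching`, ★ `mem_cornersW_iff` (`corners W = corners D ∪ {a, b}`), `N¹_mem_cornersW_iff` / `N²_mem_cornersW_iff`;
* §3 ★★ THE PARITY WALK of a configuration `ζ ∈ W^{W}_z(s)` (`s` touching `G`): `nbond₁_mem_iff` (along `h₁`: one flip at `a`), `nbond₂_zero_mem_iff` (the three-valent junction `J`:
  `nb²_0 ∈ ζ ↔ (nb¹_0 ∈ ζ ↔ I ∈ ζ)`), `nbond₂_mem_iff` (along `h₂`: one flip at `b`) — so the new-bond part of `ζ` is determined by the two bits `x = [nb¹_0 ∈ ζ]`, `y = [I ∈ ζ]`.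

The four values of `(x, y)` are the four terms of the identity (cap / `P,Q` / `P,c` / `c,Q`); the count identity and the law assembly are typed in the sequel «LAW-TWO-CELL-CAP».

## References
* M. Khristoforov, S. Smirnov, *Percolation and O(1) loop model*, arXiv:2111.15612v1 (2021), §1.2 (p. 2: loop configurations with boundary disorders, «IP(ξ) is a union of
  disjoint paths, matching marked points»; p. 3: the colouring ↔ loop-configuration correspondence), §2 Definition 3 (p. 4).
* B. Bollobás, O. Riordan, *Percolation*, Cambridge University Press 2006, Ch. 7 §7.2.2 pp. 168–169 (discrete domains of the hexagonal lattice; attaching hexagons along the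
  boundary; marked sites).
* P. A. Pearce, V. Rittenberg, J. de Gier, B. Nienhuis, *Temperley–Lieb stochastic processes*, J. Phys. A 35 (2002) L661–L668, §2 (the cup–cap `e_j`; link patterns).

## Mathlib / tree
Tree: `MarkedLoopLawSlide` (`nbond`, `nbond_inj`, `outer_ne_nbond`, `side_N_idx`, `side_N_idx_add_one/two`, `eq_N_or_of_inc`, `side_ne_nbond_of_not_mem`, `odd_xiDeg_iff_not_iff`,
`N_inj`, `exists_eq_N_of_mem`, `SlideData.EQ`, `SlideData.mem_EQ_iff`, `SlideData.nbond_mem_EQ_iff`, `SlideData.odd_xiDeg_N_iff`, `SlideData.adj_N_succ`), `MarkedLoopLawContract`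
(`EN`, `eq_castSucc_or_succ_or_skip`), `MarkedLoopPendantRootless` (`odd_xiDeg_iff_three`), `MarkedLoopSpace` (`hBonds`, `mem_hBonds`, `exists_rep_of_mem_hBonds`, `corners`,
`mem_corners`, `yc`, `yc_injective`, `yc_mem_touching`, `mem_touching_of_side_mem`), `KhSThreeDisorderObservable` (`TXb`, `mem_TXb_iff`, `ParityIs`), `TriDiscShelling`
(`leftFaceDir`, `leftFaceIdx`, `RemovableAt.hexFaceVertices_leftFaceDir`, `RemovableAt.leftFaceDir_injective`, `triDir_add_three`, `triDir_add_triDir_add_two`, `triDir_injective`,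
`add_triDir_ne`, `mem_triFacesTouching`, `triGraph_adj_iff_triDir`, `triGraph_adj_add_triDir`), `TriFaceLabel` (`leftFace_add_triDir`, `leftFace_add_triDir_rev`),
`PolylineTransitFaces` (`leftFaceDir_add_triDir`), `LatticeModels/TemperleyLiebCapContract` (`skip`, `skip_ne_castSucc/succ`). Mathlib: `Sym2.eq_iff`, `Finset.mem_symmDiff`.
-/

open Finset

namespace Literature.Probability.Percolation.MarkedLoops

open Literature.Probability.Percolation Literature.Probability.LatticeModels
open Literature.Probability.LatticeModels.TemperleyLieb
open Literature.Probability.Percolation.FivePoint (side side_injective XiLinked Inc inc_side inc_mk_iff xiDeg)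
open Literature.Probability.Percolation.FivePoint.N5 (sideGraph side_oppFace_oppIdx xiLinked_iff_reachable l1_xiDeg_eq ht2_sideGraph_mono)
open TriMarkedDomain

/-! ## §1 `D`-free lemmas: the one-flip walk, the half path `EQ`, two adjacent hexagons -/

section DFree

variable {h : Site 2}

/-- ★ **THE ONE-FLIP WALK, `D`-free**: if along the faces `N_{r+k}`, `k < m`, of the hexagon `h` the presence of the consecutive bonds `nb (k+1)`, `nb k` in `ζ` differs exactly at
`k = k₀`, then `nb k ∈ ζ ↔ (nb 0 ∈ ζ ↔ k ≤ k₀)` for all `k ≤ m` (the pure `Fin 6` bookkeeping of #848's parity walk).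
[cite: KhristoforovSmirnov2021, §1.2 (arXiv v1 pp. 2–3: loop configurations with prescribed disorders)] -/
theorem nbond_mem_iff_of_step {ζ : Finset (Sym2 (Site 2))} {r m k₀ : Fin 6}
    (step : ∀ k : Fin 6, k < m → (¬ (nbond h (r + (k + 1)) ∈ ζ ↔ nbond h (r + k) ∈ ζ) ↔ k = k₀)) {k : Fin 6} (hk : k ≤ m) :
    nbond h (r + k) ∈ ζ ↔ (nbond h r ∈ ζ ↔ k ≤ k₀) := by
  suffices H : ∀ n : ℕ, ∀ k : Fin 6, k.val = n → k ≤ m → (nbond h (r + k) ∈ ζ ↔ (nbond h r ∈ ζ ↔ k ≤ k₀)) from H k.val k rfl hk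
  intro n
  induction n with
  | zero =>
    intro k hk0 _
    have e : k = 0 := Fin.ext hk0
    subst e
    simp only [add_zero, Fin.zero_le, iff_true]
  | succ n ih =>
    intro k hkn hkm
    have hv : (k + 5).val = k.val - 1 := by omega
    have hs' : k + 5 + 1 = k := by omega
    have hlt : k + 5 < m := by rw [Fin.lt_def, hv]; rw [Fin.le_def] at hkm; omega
    have h1 := ih (k + 5) (by rw [hv]; omega) hlt.le
    have h2 := step (k + 5) hlt
    rw [hs'] at h2
    have hle : (k ≤ k₀ ↔ (k + 5 ≤ k₀ ∧ k + 5 ≠ k₀)) := by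
      rw [Fin.le_def, Fin.le_def, Ne, Fin.ext_iff, hv]; omega
    rw [hle]
    by_cases hU : k + 5 = k₀
    · have hV : k + 5 ≤ k₀ := hU.le
      have hXY : ¬ (nbond h (r + k) ∈ ζ ↔ nbond h (r + (k + 5)) ∈ ζ) := h2.2 hU
      have h1' : (nbond h (r + (k + 5)) ∈ ζ ↔ nbond h r ∈ ζ) := by
        rw [h1]; exact ⟨fun h' => h'.2 hV, fun h' => ⟨fun _ => hV, fun _ => h'⟩⟩
      have hF : ¬ (k + 5 ≤ k₀ ∧ k + 5 ≠ k₀) := fun h' => h'.2 hU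
      rw [iff_false_intro hF]
      rw [h1'] at hXY
      constructor
      · intro hX; exact ⟨fun hZ => hXY ⟨fun _ => hZ, fun _ => hX⟩, fun hf => hf.elim⟩
      · intro hZ
        by_contra hX
        exact hXY ⟨fun hX' => absurd hX' hX, fun hZ' => absurd hZ' (fun hZ'' => (hZ.1 hZ''))⟩
    · have hXY : (nbond h (r + k) ∈ ζ ↔ nbond h (r + (k + 5)) ∈ ζ) := by
        by_contra hne; exact hU (h2.1 hne)
      have hT : (k + 5 ≤ k₀ ∧ k + 5 ≠ k₀) ↔ k + 5 ≤ k₀ := ⟨fun h' => h'.1, fun h' => ⟨h', hU⟩⟩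
      rw [hXY, h1, hT]

/-! ### The half path `EQ h r m k₀` (`nb k`, `k₀ < k ≤ m`), `D`-free -/

/-- `Fin 6` facts for the half path. [cite: BollobasRiordan2006, Ch. 7 §7.2.2 p. 168; lane plumbing] -/
private theorem finQ₃ (k m k₀ : Fin 6) (hm : m.val ≤ 4) (h0 : k₀ < m) :
    (k₀ < k → k ≤ m → (k < m ∨ k = m) ∧ k + 5 < m ∧ k₀ ≤ k + 5) ∧ (¬ ((k₀ < k + 1 ∧ k + 1 ≤ m) ↔ (k₀ < k ∧ k ≤ m)) ↔ (k = k₀ ∨ k = m)) := by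
  revert hm h0; revert k m k₀; decide

/-- ★ **the side count of the half path `EQ` at `N_{r+k}` is odd exactly at `k = k₀` and `k = m`** (its two ends). [cite: KhristoforovSmirnov2021, §1.2 (arXiv v1 p. 2: `IP(ξ)` is a union of disjoint paths)] -/
theorem odd_xiDeg_EQ_iff {r m k₀ : Fin 6} (hm : m.val ≤ 4) (h0 : k₀ < m) (k : Fin 6) :
    Odd (xiDeg (SlideData.EQ h r m k₀) (leftFaceDir h (r + k))) ↔ k = k₀ ∨ k = m := by
  rw [SlideData.odd_xiDeg_N_iff (fun b hb => by obtain ⟨l, -, e⟩ := SlideData.mem_EQ_iff.1 hb; exact ⟨r + l, e⟩) (r + k), add_assoc,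
    SlideData.nbond_mem_EQ_iff, SlideData.nbond_mem_EQ_iff]
  exact (finQ₃ k m k₀ hm h0).2

/-- ★ **the half path `EQ` joins `N_{r+k₀}` to `N_{r+m}`** inside its own side graph. [cite: KhristoforovSmirnov2021, §1.2 (arXiv v1 p. 2)] -/
theorem EQ_reachable {r m k₀ : Fin 6} (h0 : k₀ < m) :
    (sideGraph (SlideData.EQ h r m k₀)).Reachable (leftFaceDir h (r + k₀)) (leftFaceDir h (r + m)) := by
  suffices H : ∀ n : ℕ, ∀ k : Fin 6, k.val = k₀.val + n → k ≤ m →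
      (sideGraph (SlideData.EQ h r m k₀)).Reachable (leftFaceDir h (r + k₀)) (leftFaceDir h (r + k)) from
    H (m.val - k₀.val) m (by rw [Fin.lt_def] at h0; omega) le_rfl
  intro n
  induction n with
  | zero =>
    intro k hk _
    rw [show k = k₀ from Fin.ext (by omega)]
  | succ n ih =>
    intro k hk hkm
    have hk1 : 1 ≤ k.val := by omega
    have hv : (k + 5).val = k.val - 1 := by omega
    have hs : k + 5 + 1 = k := by omega
    have h' := ih (k + 5) (by rw [hv]; omega) (by rw [Fin.le_def, hv]; rw [Fin.le_def] at hkm; omega)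
    refine h'.trans (SimpleGraph.Adj.reachable ?_)
    have hadj := SlideData.adj_N_succ (E := SlideData.EQ h r m k₀) (r + (k + 5)) (by
      rw [add_assoc, hs, SlideData.nbond_mem_EQ_iff]
      exact ⟨by rw [Fin.lt_def]; omega, hkm⟩)
    rwa [add_assoc, hs] at hadj

/-- **the faces of the half path `EQ`**: `N_{r+k}`, `k₀ ≤ k < m`, or its end `N_{r+m}`. [cite: KhristoforovSmirnov2021, §1.2 (arXiv v1 p. 2)] -/
theorem EQ_faces {r m k₀ : Fin 6} (hm : m.val ≤ 4) (h0 : k₀ < m) {b : Sym2 (Site 2)} (hb : b ∈ SlideData.EQ h r m k₀) {F : HexVertex} (hF : Inc F b) :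
    (∃ k : Fin 6, k₀ ≤ k ∧ k < m ∧ F = leftFaceDir h (r + k)) ∨ F = leftFaceDir h (r + m) := by
  obtain ⟨k, hk, rfl⟩ := SlideData.mem_EQ_iff.1 hb
  have hf := (finQ₃ k m k₀ hm h0).1 hk.1 hk.2
  rcases eq_N_or_of_inc (r + k) hF with rfl | rfl
  · rcases hf.1 with h1 | rfl
    · exact Or.inl ⟨k, hk.1.le, h1, rfl⟩
    · exact Or.inr rfl
  · rw [add_assoc]
    exact Or.inl ⟨k + 5, hf.2.2, hf.2.1, rfl⟩

/-- every bond of `EQ` is an `nbond h`. [cite: KhristoforovSmirnov2021, §1.2 (arXiv v1 p. 2)] -/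
theorem exists_eq_nbond_of_mem_EQ {r m k₀ : Fin 6} {b : Sym2 (Site 2)} (hb : b ∈ SlideData.EQ h r m k₀) : ∃ l : Fin 6, b = nbond h l := by
  obtain ⟨k, -, rfl⟩ := SlideData.mem_EQ_iff.1 hb
  exact ⟨r + k, rfl⟩

/-- `h` lies on every face `N_{r+k}(h)` of its ring. [cite: BollobasRiordan2006, Ch. 7 §7.2.2 p. 168; lane plumbing] -/
theorem self_mem_N (h : Site 2) (r k : Fin 6) : h ∈ hexFaceVertices (leftFaceDir h (r + k)) := by
  rw [RemovableAt.hexFaceVertices_leftFaceDir]; exact Finset.mem_insert_self _ _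

/-! ### Two adjacent hexagons `h` and `h + e_d` -/

/-- `Fin 6` facts. [folklore] -/
private theorem fin6_basic (j : Fin 6) : j + 1 + 5 = j ∧ j + 5 + 1 = j ∧ j + 4 + 2 = j ∧ j + 4 + 1 = j + 5 ∧ j + 2 + 1 = j + 3 := by
  revert j; decide

/-- `h + e_d + e_{d+2} = h + e_{d+1}`. [cite: BollobasRiordan2006, Ch. 7 §7.2.2 p. 168; lane plumbing] -/
theorem add_triDir_add_triDir_add_two' (h : Site 2) (d : Fin 6) : h + triDir d + triDir (d + 2) = h + triDir (d + 1) := by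
  rw [add_assoc, triDir_add_triDir_add_two]

/-- `h + e_d + e_{d+3} = h`. [cite: BollobasRiordan2006, Ch. 7 §7.2.2 p. 168; lane plumbing] -/
theorem add_triDir_add_triDir_add_three' (h : Site 2) (d : Fin 6) : h + triDir d + triDir (d + 3) = h := by
  rw [triDir_add_three, add_neg_cancel_right]

/-- ★ **across the bond `{h, h + e_d}`**: the face `N_{d+5}(h)` (right of the dart `h → h + e_d`) is the face `N_{d+3}(h + e_d)`.
[cite: BollobasRiordan2006, Ch. 7 §7.2.2 p. 168; lane plumbing] -/
theorem leftFaceDir_add_triDir_add_three (h : Site 2) (d : Fin 6) : leftFaceDir (h + triDir d) (d + 3) = leftFaceDir h (d + 5) := by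
  have h1 := leftFace_add_triDir (h + triDir d) (d + 3)
  rw [add_triDir_add_triDir_add_three', leftFace_add_triDir_rev] at h1
  exact h1.symm

/-- `h + e_d` lies on the face `N_j(h)` iff `j = d` or `j = d + 5`. [cite: BollobasRiordan2006, Ch. 7 §7.2.2 p. 168; lane plumbing] -/
theorem add_triDir_mem_hexFaceVertices_N_iff (h : Site 2) (d j : Fin 6) :
    h + triDir d ∈ hexFaceVertices (leftFaceDir h j) ↔ j = d ∨ j = d + 5 := by
  rw [RemovableAt.hexFaceVertices_leftFaceDir, Finset.mem_insert, Finset.mem_insert, Finset.mem_singleton]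
  constructor
  · rintro (e | e | e)
    · exact absurd e (add_triDir_ne h d)
    · exact Or.inl (triDir_injective (add_left_cancel e)).symm
    · right
      rw [triDir_injective (add_left_cancel e), (fin6_basic j).1]
  · rintro (rfl | rfl)
    · exact Or.inr (Or.inl rfl)
    · right; right; rw [(fin6_basic d).2.1]

/-- `h` lies on the face `N_j(h + e_d)` iff `j = d + 2` or `j = d + 3`. [cite: BollobasRiordan2006, Ch. 7 §7.2.2 p. 168; lane plumbing] -/
theorem mem_hexFaceVertices_N_add_triDir_iff (h : Site 2) (d j : Fin 6) :
    h ∈ hexFaceVertices (leftFaceDir (h + triDir d) j) ↔ j = d + 2 ∨ j = d + 3 := by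
  have key : ∀ t : Fin 6, h = h + triDir d + triDir t ↔ t = d + 3 := by
    intro t
    constructor
    · intro e
      have e' : triDir d + triDir t = 0 := by
        have := e.symm; rw [add_assoc] at this
        exact add_left_cancel (a := h) (by rw [this, add_zero])
      have e'' : triDir t = triDir (d + 3) := by rw [triDir_add_three]; exact (neg_eq_of_add_eq_zero_right e').symm
      exact triDir_injective e''
    · rintro rfl; exact (add_triDir_add_triDir_add_three' h d).symm
  rw [RemovableAt.hexFaceVertices_leftFaceDir, Finset.mem_insert, Finset.mem_insert, Finset.mem_singleton, key, key]
  constructor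
  · rintro (e | e | e)
    · exact absurd e.symm (add_triDir_ne h d)
    · exact Or.inr e
    · left
      have e6 := (fin6_basic d).2.2.2.2
      have : j = j + 1 + 5 := (fin6_basic j).1.symm
      rw [this, e, ← e6, (fin6_basic (d + 2)).1]
  · rintro (rfl | rfl)
    · right; right; exact (fin6_basic d).2.2.2.2
    · exact Or.inr (Or.inl rfl)

/-- ★ **the bonds at `h` and at `h + e_d` have exactly the bond `{h, h + e_d}` in common**: `nbond h s = nbond (h + e_d) t ↔ s = d ∧ t = d + 3`.
[cite: BollobasRiordan2006, Ch. 7 §7.2.2 p. 168; lane plumbing] -/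
theorem nbond_eq_nbond_add_triDir_iff (h : Site 2) (d s t : Fin 6) : nbond h s = nbond (h + triDir d) t ↔ s = d ∧ t = d + 3 := by
  unfold nbond
  rw [Sym2.eq_iff]
  constructor
  · rintro (⟨e1, -⟩ | ⟨e1, e2⟩)
    · exact absurd e1.symm (add_triDir_ne h d)
    · have hs : s = d := triDir_injective (add_left_cancel e2)
      refine ⟨hs, ?_⟩
      have ht := (mem_hexFaceVertices_N_add_triDir_iff h d t).1 (by
        rw [RemovableAt.hexFaceVertices_leftFaceDir, Finset.mem_insert, Finset.mem_insert]
        exact Or.inr (Or.inl e1))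
      rcases ht with rfl | rfl
      · exfalso
        have e3 : h + triDir d + triDir (d + 2) = h + triDir (d + 1) := add_triDir_add_triDir_add_two' h d
        rw [← e1] at e3
        exact add_triDir_ne h (d + 1) e3.symm
      · rfl
  · rintro ⟨rfl, rfl⟩
    exact Or.inr ⟨(add_triDir_add_triDir_add_three' h s).symm, rfl⟩

end DFree

/-! ## §2 The two-cell datum: two adjacent hexagons attached, one new corner on each -/

section TwoCell

variable {nm : ℕ}

/-- **TWO ADJACENT HEXAGONS ATTACHED, ONE NEW DISORDER ON EACH.** `D = (Ω; M̂)` (`k` corners) on the sites `G`; `W = (Ω ∪ h₁ ∪ h₂; M̂ + a + b)` (`k+2` corners) on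
`G ∪ {h₁, h₂}`, `h₁, h₂ ∉ G`, `h₂ = h₁ + e_{r₁+m₁+1}`: around `h₁` the cells at offsets `k ≤ m₁` from `r₁` are outside, `h₂` sits at offset `m₁ + 1`, the cells at offsets
`k ≥ m₁ + 2` are in `G`; around `h₂` (base `r₂ = r₁ + m₁ + 5`: its first outer cell is the last outer cell of `h₁`) the cells at offsets `k ≤ m₂` are outside, those at
`m₂ < k ≤ 4` in `G`, and `h₁` sits at offset `5` (`m₁, m₂ ≤ 3`). The corners of `W`: those of `D` relabelled by `skip j`, and the outer faces `a = N¹_{k₁}` (`k₁ < m₁`) of `h₁` and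
`b = N²_{k₂}` (`k₂ < m₂`) of `h₂` at the two adjacent indices `{ja, jb} = {j, j+1}`.
[cite: KhristoforovSmirnov2021, §1.2 (arXiv v1 pp. 2–3: disorders on the boundary); BollobasRiordan2006, Ch. 7 §7.2.2 pp. 168–169 (attaching hexagons; marked sites)] -/
structure TwoCellData (W : TriMarkedDomain (nm + 1 + 1)) (D : TriMarkedDomain nm) (h₁ h₂ : Site 2) (r₁ m₁ k₁ r₂ m₂ k₂ : Fin 6)
    (ja jb : Fin (nm + 1 + 1)) (j : Fin (nm + 1)) : Prop where
  /-- the big domain is the small one plus the two hexagons -/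
  verts' : W.verts = insert h₁ (insert h₂ D.verts)
  /-- `h₁` is a new site -/
  notMem₁ : h₁ ∉ D.verts
  /-- `h₂` is a new site -/
  notMem₂ : h₂ ∉ D.verts
  /-- `h₂` is the ring neighbour of `h₁` right after its outer run -/
  h₂_eq : h₂ = h₁ + triDir (r₁ + (m₁ + 1))
  /-- the ring base of `h₂`: its first outer cell is the last outer cell of `h₁` -/
  r₂_eq : r₂ = r₁ + (m₁ + 5)
  /-- the outer run of `h₁` -/
  out₁ : ∀ k : Fin 6, k ≤ m₁ → h₁ + triDir (r₁ + k) ∉ D.verts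
  /-- the contact arc of `h₁` -/
  in₁ : ∀ k : Fin 6, m₁ + 1 < k → h₁ + triDir (r₁ + k) ∈ D.verts
  /-- the outer run of `h₂` -/
  out₂ : ∀ k : Fin 6, k ≤ m₂ → h₂ + triDir (r₂ + k) ∉ D.verts
  /-- the contact arc of `h₂` -/
  in₂ : ∀ k : Fin 6, m₂ < k → k ≠ 5 → h₂ + triDir (r₂ + k) ∈ D.verts
  /-- `h₁` has at least one contact cell besides `h₂` -/
  m₁_le : m₁.val ≤ 3
  /-- `h₂` has at least one contact cell besides `h₁` -/
  m₂_le : m₂.val ≤ 3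
  /-- `a` is an outer face of `h₁` strictly before the junction -/
  k₁_lt : k₁ < m₁
  /-- `b` is an outer face of `h₂` strictly before `Q` -/
  k₂_lt : k₂ < m₂
  /-- the old corner faces, relabelled -/
  yc_skip : ∀ i, yc W (skip j i) = yc D i
  /-- the two new corners sit at the adjacent indices `j, j+1`, in either order -/
  pair : (ja = Fin.castSucc j ∧ jb = j.succ) ∨ (ja = j.succ ∧ jb = Fin.castSucc j)
  /-- the new corner `a` -/
  yc_a : yc W ja = leftFaceDir h₁ (r₁ + k₁)
  /-- the new corner `b` -/
  yc_b : yc W jb = leftFaceDir h₂ (r₂ + k₂)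

namespace TwoCellData

variable {W : TriMarkedDomain (nm + 1 + 1)} {D : TriMarkedDomain nm} {h₁ h₂ : Site 2} {r₁ m₁ k₁ r₂ m₂ k₂ : Fin 6} {ja jb : Fin (nm + 1 + 1)} {j : Fin (nm + 1)}
  (T : TwoCellData W D h₁ h₂ r₁ m₁ k₁ r₂ m₂ k₂ ja jb j)
include T

/-! ### `Fin 6` bookkeeping -/

omit T in
/-- the ring base of `h₂` against the direction of `h₂` from `h₁`. [cite: BollobasRiordan2006, Ch. 7 §7.2.2 p. 168; lane plumbing] -/
private theorem fin6_r (r₁ m₁ : Fin 6) :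
    r₁ + (m₁ + 5) + 5 = r₁ + (m₁ + 1) + 3 ∧ r₁ + (m₁ + 5) = r₁ + (m₁ + 1) + 4 ∧ r₁ + (m₁ + 5) + 4 = r₁ + (m₁ + 1) + 2 ∧
      r₁ + (m₁ + 1) + 5 = r₁ + m₁ ∧ r₁ + (m₁ + 1) + 1 = r₁ + (m₁ + 2) := by
  revert r₁ m₁; decide

omit T in
/-- offsets of `h₁` seen from `h₂`. [cite: BollobasRiordan2006, Ch. 7 §7.2.2 p. 168; lane plumbing] -/
private theorem fin6_d (d k : Fin 6) : (d + 4 + k = d + 2 ↔ k = 4) ∧ (d + 4 + k = d + 3 ↔ k = 5) ∧ d + (k + 1) = d + k + 1 := by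
  revert d k; decide

omit T in
/-- the outer run against `m ≤ 3`. [cite: BollobasRiordan2006, Ch. 7 §7.2.2 p. 168; lane plumbing] -/
private theorem fin6_mA (m k : Fin 6) (hm : m.val ≤ 3) :
    (k ≤ m → k ≠ m + 1 ∧ k ≠ 5 ∧ k ≠ 4) ∧ (k ≤ m + 1 → k ≤ m ∨ k = m + 1) ∧ (k < m → k + 1 ≤ m) ∧ (¬ k ≤ m → m + 1 ≤ k) := by
  revert hm; revert m k; decide

omit T in
/-- the contact arc against `m ≤ 3`. [cite: BollobasRiordan2006, Ch. 7 §7.2.2 p. 168; lane plumbing] -/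
private theorem fin6_mB (m k : Fin 6) (hm : m.val ≤ 3) :
    (m + 1 ≤ k → k ≠ m + 1 → m + 1 < k) ∧ (m ≤ k → k ≠ 4 → k ≠ 5 → m < k + 1 ∧ k + 1 ≠ 5) := by
  revert hm; revert m k; decide

omit T in
/-- the end offsets against `m ≤ 3`. [cite: BollobasRiordan2006, Ch. 7 §7.2.2 p. 168; lane plumbing] -/
private theorem fin6_mC (m : Fin 6) (hm : m.val ≤ 3) :
    m + 1 < 5 ∧ m + 1 < m + 2 ∧ m < m + 1 ∧ m + 1 ≠ (5 : Fin 6) ∧ m < 4 ∧ (m + 1) + 5 = m := by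
  revert hm; revert m; decide

/-! ### Sites -/

/-- `h₁ ∈ G'`. [cite: BollobasRiordan2006, Ch. 7 §7.2.2 p. 168] -/
theorem h₁_mem : h₁ ∈ W.verts := by rw [T.verts']; exact Finset.mem_insert_self _ _

/-- `h₂ ∈ G'`. [cite: BollobasRiordan2006, Ch. 7 §7.2.2 p. 168] -/
theorem h₂_mem : h₂ ∈ W.verts := by rw [T.verts']; exact Finset.mem_insert_of_mem (Finset.mem_insert_self _ _)

/-- `G ⊆ G'`. [cite: BollobasRiordan2006, Ch. 7 §7.2.2 p. 168] -/
theorem verts_subset : D.verts ⊆ W.verts := by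
  rw [T.verts']; exact (Finset.subset_insert _ _).trans (Finset.subset_insert _ _)

/-- `H_G ⊆ H_{G'}`. [cite: KhristoforovSmirnov2021, §1.2 (arXiv v1 p. 2)] -/
theorem hBonds_subset : hBonds D ⊆ hBonds W := by
  intro b hb
  obtain ⟨u, w, rfl, hu, hadj⟩ := exists_rep_of_mem_hBonds D hb
  exact mem_hBonds W hadj (Or.inl (T.verts_subset hu))

/-- `h₁ ≠ h₂`. [cite: BollobasRiordan2006, Ch. 7 §7.2.2 p. 168] -/
theorem h₁_ne_h₂ : h₁ ≠ h₂ := by rw [T.h₂_eq]; exact fun e => add_triDir_ne h₁ _ e.symm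

/-! ### The junction identities -/

/-- `h₁` is the cell at offset `5` around `h₂`. [cite: BollobasRiordan2006, Ch. 7 §7.2.2 p. 168] -/
theorem h₁_eq : h₂ + triDir (r₂ + 5) = h₁ := by
  rw [T.r₂_eq, T.h₂_eq, (fin6_r r₁ m₁).1, add_triDir_add_triDir_add_three']

/-- the first outer cell of `h₂` is the last outer cell of `h₁`. [cite: BollobasRiordan2006, Ch. 7 §7.2.2 p. 168] -/
theorem o_eq : h₂ + triDir r₂ = h₁ + triDir (r₁ + m₁) := by
  rw [T.r₂_eq, T.h₂_eq, (fin6_r r₁ m₁).2.1, add_triDir_add_triDir_add_four, (fin6_r r₁ m₁).2.2.2.1]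

/-- the common contact cell `s`: offset `4` around `h₂`, offset `m₁ + 2` around `h₁`. [cite: BollobasRiordan2006, Ch. 7 §7.2.2 p. 168] -/
theorem s_eq : h₂ + triDir (r₂ + 4) = h₁ + triDir (r₁ + (m₁ + 2)) := by
  rw [T.r₂_eq, T.h₂_eq, (fin6_r r₁ m₁).2.2.1, add_triDir_add_triDir_add_two', (fin6_r r₁ m₁).2.2.2.2]

/-- ★ **the outer junction** `J = N²_5 = N¹_{m₁}`. [cite: BollobasRiordan2006, Ch. 7 §7.2.2 p. 168] -/
theorem J_eq : leftFaceDir h₂ (r₂ + 5) = leftFaceDir h₁ (r₁ + m₁) := by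
  rw [T.r₂_eq, T.h₂_eq, (fin6_r r₁ m₁).1, leftFaceDir_add_triDir_add_three, (fin6_r r₁ m₁).2.2.2.1]

/-- ★ **the inner junction** `c = N²_4 = N¹_{m₁+1}`. [cite: BollobasRiordan2006, Ch. 7 §7.2.2 p. 168] -/
theorem c_eq : leftFaceDir h₂ (r₂ + 4) = leftFaceDir h₁ (r₁ + (m₁ + 1)) := by
  rw [T.r₂_eq, T.h₂_eq, (fin6_r r₁ m₁).2.2.1, leftFaceDir_add_triDir]

/-- ★ **the interior bond** `I = nb²_5 = nb¹_{m₁+1} = {h₁, h₂}`. [cite: KhristoforovSmirnov2021, §1.2 (arXiv v1 p. 2)] -/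
theorem I_eq : nbond h₂ (r₂ + 5) = nbond h₁ (r₁ + (m₁ + 1)) := by
  rw [T.r₂_eq, T.h₂_eq, (fin6_r r₁ m₁).1]
  exact ((nbond_eq_nbond_add_triDir_iff h₁ (r₁ + (m₁ + 1)) (r₁ + (m₁ + 1)) (r₁ + (m₁ + 1) + 3)).2 ⟨rfl, rfl⟩).symm

/-- `h₂` lies on `N¹_k` iff `k = m₁` (the junction `J`) or `k = m₁ + 1` (the junction `c`). [cite: BollobasRiordan2006, Ch. 7 §7.2.2 p. 168] -/
theorem h₂_mem_N₁_iff (k : Fin 6) : h₂ ∈ hexFaceVertices (leftFaceDir h₁ (r₁ + k)) ↔ k = m₁ ∨ k = m₁ + 1 := by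
  rw [T.h₂_eq, add_triDir_mem_hexFaceVertices_N_iff, add_assoc r₁ (m₁ + 1) 5, (fin6_mC m₁ T.m₁_le).2.2.2.2.2, add_right_inj, add_right_inj, or_comm]

/-- `h₁` lies on `N²_k` iff `k = 4` (the junction `c`) or `k = 5` (the junction `J`). [cite: BollobasRiordan2006, Ch. 7 §7.2.2 p. 168] -/
theorem h₁_mem_N₂_iff (k : Fin 6) : h₁ ∈ hexFaceVertices (leftFaceDir h₂ (r₂ + k)) ↔ k = 4 ∨ k = 5 := by
  rw [T.h₂_eq, T.r₂_eq, (fin6_r r₁ m₁).2.1, mem_hexFaceVertices_N_add_triDir_iff, (fin6_d _ k).1, (fin6_d _ k).2.1]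

/-- `N¹_k = N²_{k'}` forces `k ∈ {m₁, m₁ + 1}` and `k' ∈ {4, 5}`. [cite: BollobasRiordan2006, Ch. 7 §7.2.2 p. 168] -/
theorem N₁_eq_N₂_imp {k k' : Fin 6} (e : leftFaceDir h₁ (r₁ + k) = leftFaceDir h₂ (r₂ + k')) : (k = m₁ ∨ k = m₁ + 1) ∧ (k' = 4 ∨ k' = 5) :=
  ⟨(T.h₂_mem_N₁_iff k).1 (e ▸ self_mem_N h₂ r₂ k'), (T.h₁_mem_N₂_iff k').1 (e ▸ self_mem_N h₁ r₁ k)⟩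

/-! ### The outer cells are outside `G'` -/

/-- the outer cells of `h₁` are outside `G'`. [cite: BollobasRiordan2006, Ch. 7 §7.2.2 p. 168] -/
theorem out₁' {k : Fin 6} (hk : k ≤ m₁) : h₁ + triDir (r₁ + k) ∉ W.verts := by
  rw [T.verts', Finset.mem_insert, Finset.mem_insert]
  rintro (e | e | e)
  · exact add_triDir_ne h₁ _ e
  · rw [T.h₂_eq] at e
    exact ((fin6_mA m₁ k T.m₁_le).1 hk).1 (add_left_cancel (triDir_injective (add_left_cancel e)))
  · exact T.out₁ k hk e

/-- the outer cells of `h₂` are outside `G'`. [cite: BollobasRiordan2006, Ch. 7 §7.2.2 p. 168] -/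
theorem out₂' {k : Fin 6} (hk : k ≤ m₂) : h₂ + triDir (r₂ + k) ∉ W.verts := by
  rw [T.verts', Finset.mem_insert, Finset.mem_insert]
  rintro (e | e | e)
  · rw [← T.h₁_eq] at e
    exact ((fin6_mA m₂ k T.m₂_le).1 hk).2.1 (add_left_cancel (triDir_injective (add_left_cancel e)))
  · exact add_triDir_ne h₂ _ e
  · exact T.out₂ k hk e

/-! ### Bonds: `H_{G'} = H_G ⊔ {nb¹_k : k ≤ m₁ + 1} ⊔ {nb²_k : k ≤ m₂}` -/

/-- ★ **the bonds of `H_{G'}`**: those of `H_G`, the new bonds `nb¹_k`, `k ≤ m₁ + 1`, at `h₁` (the last one is the interior bond `{h₁, h₂}`), and the new bonds `nb²_k`, `k ≤ m₂`, at `h₂`.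
[cite: KhristoforovSmirnov2021, §1.2 (arXiv v1 p. 2: the edges of `H_Ω`); BollobasRiordan2006, Ch. 7 §7.2.2 p. 168] -/
theorem mem_hBondsW_iff {b : Sym2 (Site 2)} : b ∈ hBonds W ↔
    b ∈ hBonds D ∨ (∃ k : Fin 6, k ≤ m₁ + 1 ∧ b = nbond h₁ (r₁ + k)) ∨ (∃ k : Fin 6, k ≤ m₂ ∧ b = nbond h₂ (r₂ + k)) := by
  constructor
  · intro hb
    obtain ⟨u, w, rfl, hu, hadj⟩ := exists_rep_of_mem_hBonds W hb
    rw [T.verts', Finset.mem_insert, Finset.mem_insert] at hu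
    rcases hu with rfl | rfl | hu
    · obtain ⟨l, rfl⟩ := (triGraph_adj_iff_triDir _ w).1 hadj
      obtain ⟨k, rfl⟩ : ∃ k : Fin 6, l = r₁ + k := ⟨l - r₁, by rw [add_sub_cancel]⟩
      by_cases hk : k ≤ m₁ + 1
      · exact Or.inr (Or.inl ⟨k, hk, rfl⟩)
      · exact Or.inl (mem_hBonds D hadj (Or.inr (T.in₁ k (not_le.1 hk))))
    · obtain ⟨l, rfl⟩ := (triGraph_adj_iff_triDir _ w).1 hadj
      obtain ⟨k, rfl⟩ : ∃ k : Fin 6, l = r₂ + k := ⟨l - r₂, by rw [add_sub_cancel]⟩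
      by_cases hk : k ≤ m₂
      · exact Or.inr (Or.inr ⟨k, hk, rfl⟩)
      · by_cases h5 : k = 5
        · subst h5
          refine Or.inr (Or.inl ⟨m₁ + 1, le_rfl, ?_⟩)
          rw [T.h₁_eq, Sym2.eq_swap, T.h₂_eq]; rfl
        · exact Or.inl (mem_hBonds D hadj (Or.inr (T.in₂ k (not_le.1 hk) h5)))
    · exact Or.inl (mem_hBonds D hadj (Or.inl hu))
  · rintro (hb | ⟨k, -, rfl⟩ | ⟨k, -, rfl⟩)
    · exact T.hBonds_subset hb
    · exact mem_hBonds W (triGraph_adj_add_triDir h₁ _) (Or.inl T.h₁_mem)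
    · exact mem_hBonds W (triGraph_adj_add_triDir h₂ _) (Or.inl T.h₂_mem)

/-- the new bonds at `h₁` are not bonds of `H_G`. [cite: KhristoforovSmirnov2021, §1.2 (arXiv v1 p. 2)] -/
theorem new₁_not_mem_hBonds {k : Fin 6} (hk : k ≤ m₁ + 1) : nbond h₁ (r₁ + k) ∉ hBonds D := by
  intro hb
  obtain ⟨u, w, he, hu, -⟩ := exists_rep_of_mem_hBonds D hb
  have hu' : u ∈ (nbond h₁ (r₁ + k) : Sym2 (Site 2)) := by rw [he]; exact Sym2.mem_mk_left u w
  rcases Sym2.mem_iff.1 hu' with rfl | rfl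
  · exact T.notMem₁ hu
  · rcases ((fin6_mA m₁ k T.m₁_le).2.1 hk) with hk' | rfl
    · exact T.out₁ k hk' hu
    · rw [← T.h₂_eq] at hu; exact T.notMem₂ hu

/-- the new bonds at `h₂` are not bonds of `H_G`. [cite: KhristoforovSmirnov2021, §1.2 (arXiv v1 p. 2)] -/
theorem new₂_not_mem_hBonds {k : Fin 6} (hk : k ≤ m₂) : nbond h₂ (r₂ + k) ∉ hBonds D := by
  intro hb
  obtain ⟨u, w, he, hu, -⟩ := exists_rep_of_mem_hBonds D hb
  have hu' : u ∈ (nbond h₂ (r₂ + k) : Sym2 (Site 2)) := by rw [he]; exact Sym2.mem_mk_left u w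
  rcases Sym2.mem_iff.1 hu' with rfl | rfl
  · exact T.notMem₂ hu
  · exact T.out₂ k hk hu

/-- the interior bond is not a bond of `H_G`. [cite: KhristoforovSmirnov2021, §1.2 (arXiv v1 p. 2)] -/
theorem I_not_mem_hBonds : nbond h₁ (r₁ + (m₁ + 1)) ∉ hBonds D := T.new₁_not_mem_hBonds le_rfl

/-- the new bonds are bonds of `H_{G'}`. [cite: KhristoforovSmirnov2021, §1.2 (arXiv v1 p. 2)] -/
theorem nbond₁_mem_hBondsW (l : Fin 6) : nbond h₁ l ∈ hBonds W := mem_hBonds W (triGraph_adj_add_triDir h₁ _) (Or.inl T.h₁_mem)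

/-- the new bonds are bonds of `H_{G'}`. [cite: KhristoforovSmirnov2021, §1.2 (arXiv v1 p. 2)] -/
theorem nbond₂_mem_hBondsW (l : Fin 6) : nbond h₂ l ∈ hBonds W := mem_hBonds W (triGraph_adj_add_triDir h₂ _) (Or.inl T.h₂_mem)

/-- the outer side of `N¹_k`, `k < m₁`, is not a bond of `H_{G'}`. [cite: KhristoforovSmirnov2021, §1.2 (arXiv v1 p. 2)] -/
theorem outer₁_not_mem_hBondsW {k : Fin 6} (hk : k < m₁) : s(h₁ + triDir (r₁ + k), h₁ + triDir (r₁ + k + 1)) ∉ hBonds W := by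
  intro hb
  obtain ⟨u, w, he, hu, -⟩ := exists_rep_of_mem_hBonds W hb
  have hu' : u ∈ (s(h₁ + triDir (r₁ + k), h₁ + triDir (r₁ + k + 1)) : Sym2 (Site 2)) := by rw [he]; exact Sym2.mem_mk_left u w
  rcases Sym2.mem_iff.1 hu' with rfl | rfl
  · exact T.out₁' hk.le hu
  · rw [add_assoc r₁ k 1] at hu
    exact T.out₁' ((fin6_mA m₁ k T.m₁_le).2.2.1 hk) hu

/-- the outer side of `N²_k`, `k < m₂`, is not a bond of `H_{G'}`. [cite: KhristoforovSmirnov2021, §1.2 (arXiv v1 p. 2)] -/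
theorem outer₂_not_mem_hBondsW {k : Fin 6} (hk : k < m₂) : s(h₂ + triDir (r₂ + k), h₂ + triDir (r₂ + k + 1)) ∉ hBonds W := by
  intro hb
  obtain ⟨u, w, he, hu, -⟩ := exists_rep_of_mem_hBonds W hb
  have hu' : u ∈ (s(h₂ + triDir (r₂ + k), h₂ + triDir (r₂ + k + 1)) : Sym2 (Site 2)) := by rw [he]; exact Sym2.mem_mk_left u w
  rcases Sym2.mem_iff.1 hu' with rfl | rfl
  · exact T.out₂' hk.le hu
  · rw [add_assoc r₂ k 1] at hu
    exact T.out₂' ((fin6_mA m₂ k T.m₂_le).2.2.1 hk) hu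

/-! ### Faces -/

/-- every `N¹_k` touches `G'`. [cite: BollobasRiordan2006, Ch. 7 §7.2.2 p. 168] -/
theorem N₁_touchingW (k : Fin 6) : leftFaceDir h₁ (r₁ + k) ∈ triFacesTouching W.verts :=
  mem_triFacesTouching.2 ⟨h₁, T.h₁_mem, self_mem_N h₁ r₁ k⟩

/-- every `N²_k` touches `G'`. [cite: BollobasRiordan2006, Ch. 7 §7.2.2 p. 168] -/
theorem N₂_touchingW (k : Fin 6) : leftFaceDir h₂ (r₂ + k) ∈ triFacesTouching W.verts :=
  mem_triFacesTouching.2 ⟨h₂, T.h₂_mem, self_mem_N h₂ r₂ k⟩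

/-- ★ the outer faces `N¹_k`, `k ≤ m₁` (the junction `J` included), do NOT touch `G`. [cite: BollobasRiordan2006, Ch. 7 §7.2.2 p. 168] -/
theorem N₁_not_touching {k : Fin 6} (hk : k ≤ m₁) : leftFaceDir h₁ (r₁ + k) ∉ triFacesTouching D.verts := by
  intro ht
  obtain ⟨u, hu, huF⟩ := mem_triFacesTouching.1 ht
  rw [RemovableAt.hexFaceVertices_leftFaceDir, Finset.mem_insert, Finset.mem_insert, Finset.mem_singleton] at huF
  rcases huF with rfl | rfl | rfl
  · exact T.notMem₁ hu
  · exact T.out₁ k hk hu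
  · rcases hk.lt_or_eq with hk' | rfl
    · rw [add_assoc r₁ k 1] at hu
      exact T.out₁ (k + 1) ((fin6_mA m₁ k T.m₁_le).2.2.1 hk') hu
    · rw [add_assoc r₁ k 1, ← T.h₂_eq] at hu
      exact T.notMem₂ hu

/-- ★ the outer faces `N²_k`, `k < m₂`, do NOT touch `G`. [cite: BollobasRiordan2006, Ch. 7 §7.2.2 p. 168] -/
theorem N₂_not_touching {k : Fin 6} (hk : k < m₂) : leftFaceDir h₂ (r₂ + k) ∉ triFacesTouching D.verts := by
  intro ht
  obtain ⟨u, hu, huF⟩ := mem_triFacesTouching.1 ht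
  rw [RemovableAt.hexFaceVertices_leftFaceDir, Finset.mem_insert, Finset.mem_insert, Finset.mem_singleton] at huF
  rcases huF with rfl | rfl | rfl
  · exact T.notMem₂ hu
  · exact T.out₂ k hk.le hu
  · rw [add_assoc r₂ k 1] at hu
    exact T.out₂ (k + 1) ((fin6_mA m₂ k T.m₂_le).2.2.1 hk) hu

/-- the faces `N¹_k`, `k ≥ m₁ + 1` (the junction `c`, the contact faces, `P`), touch `G`. [cite: BollobasRiordan2006, Ch. 7 §7.2.2 p. 168] -/
theorem N₁_touching {k : Fin 6} (hk : m₁ + 1 ≤ k) : leftFaceDir h₁ (r₁ + k) ∈ triFacesTouching D.verts := by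
  have FB := fin6_mB m₁ k T.m₁_le
  have FC := fin6_mC m₁ T.m₁_le
  rw [mem_triFacesTouching]
  by_cases e : k = m₁ + 1
  · subst e
    refine ⟨h₁ + triDir (r₁ + (m₁ + 2)), T.in₁ _ FC.2.1, ?_⟩
    rw [RemovableAt.hexFaceVertices_leftFaceDir, (fin6_r r₁ m₁).2.2.2.2]; simp
  · exact ⟨h₁ + triDir (r₁ + k), T.in₁ k (FB.1 hk e), by rw [RemovableAt.hexFaceVertices_leftFaceDir]; simp⟩

/-- the faces `N²_k`, `m₂ ≤ k ≤ 4` (`Q`, the contact faces, the junction `c`), touch `G`. [cite: BollobasRiordan2006, Ch. 7 §7.2.2 p. 168] -/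
theorem N₂_touching {k : Fin 6} (hk : m₂ ≤ k) (hk5 : k ≠ 5) : leftFaceDir h₂ (r₂ + k) ∈ triFacesTouching D.verts := by
  have FB := fin6_mB m₂ k T.m₂_le
  have FC := fin6_mC m₂ T.m₂_le
  rw [mem_triFacesTouching]
  by_cases e : k = 4
  · subst e
    exact ⟨h₂ + triDir (r₂ + 4), T.in₂ 4 FC.2.2.2.2.1 (by decide), by rw [RemovableAt.hexFaceVertices_leftFaceDir]; simp⟩
  · obtain ⟨h1, h2⟩ := FB.2 hk e hk5
    refine ⟨h₂ + triDir (r₂ + (k + 1)), T.in₂ (k + 1) h1 h2, ?_⟩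
    rw [RemovableAt.hexFaceVertices_leftFaceDir, ← add_assoc r₂ k 1]; simp

/-- the first contact end `P = N¹_5` touches `G`. [cite: BollobasRiordan2006, Ch. 7 §7.2.2 p. 168] -/
theorem P_touching : leftFaceDir h₁ (r₁ + 5) ∈ triFacesTouching D.verts :=
  T.N₁_touching (fin6_mC m₁ T.m₁_le).1.le

/-- the inner junction `c = N¹_{m₁+1}` touches `G`. [cite: BollobasRiordan2006, Ch. 7 §7.2.2 p. 168] -/
theorem c_touching : leftFaceDir h₁ (r₁ + (m₁ + 1)) ∈ triFacesTouching D.verts := T.N₁_touching le_rfl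

/-- the last contact end `Q = N²_{m₂}` touches `G`. [cite: BollobasRiordan2006, Ch. 7 §7.2.2 p. 168] -/
theorem Q_touching : leftFaceDir h₂ (r₂ + m₂) ∈ triFacesTouching D.verts :=
  T.N₂_touching le_rfl ((fin6_mA m₂ m₂ T.m₂_le).1 le_rfl).2.1

/-- ★ **the faces touching `G'`**: those touching `G`, the outer faces `N¹_k`, `k ≤ m₁`, of `h₁` (junction included) and the outer faces `N²_k`, `k < m₂`, of `h₂`.
[cite: BollobasRiordan2006, Ch. 7 §7.2.2 p. 168] -/
theorem mem_touchingW_iff {F : HexVertex} : F ∈ triFacesTouching W.verts ↔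
    F ∈ triFacesTouching D.verts ∨ (∃ k : Fin 6, k ≤ m₁ ∧ F = leftFaceDir h₁ (r₁ + k)) ∨ (∃ k : Fin 6, k < m₂ ∧ F = leftFaceDir h₂ (r₂ + k)) := by
  constructor
  · intro hF
    obtain ⟨u, hu, huF⟩ := mem_triFacesTouching.1 hF
    rw [T.verts', Finset.mem_insert, Finset.mem_insert] at hu
    rcases hu with rfl | rfl | hu
    · obtain ⟨k, rfl⟩ := exists_eq_N_of_mem r₁ huF
      by_cases hk : k ≤ m₁
      · exact Or.inr (Or.inl ⟨k, hk, rfl⟩)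
      · exact Or.inl (T.N₁_touching ((fin6_mA m₁ k T.m₁_le).2.2.2 hk))
    · obtain ⟨k, rfl⟩ := exists_eq_N_of_mem r₂ huF
      by_cases hk : k < m₂
      · exact Or.inr (Or.inr ⟨k, hk, rfl⟩)
      · by_cases h5 : k = 5
        · subst h5
          rw [T.J_eq]
          exact Or.inr (Or.inl ⟨m₁, le_rfl, rfl⟩)
        · exact Or.inl (T.N₂_touching (not_lt.1 hk) h5)
    · exact Or.inl (mem_triFacesTouching.2 ⟨u, hu, huF⟩)
  · rintro (hF | ⟨k, -, rfl⟩ | ⟨k, -, rfl⟩)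
    · obtain ⟨u, hu, huF⟩ := mem_triFacesTouching.1 hF
      exact mem_triFacesTouching.2 ⟨u, T.verts_subset hu, huF⟩
    · exact T.N₁_touchingW k
    · exact T.N₂_touchingW k

/-! ### Corner faces -/

omit T in
/-- propositional bookkeeping of the index trichotomy. [cite: PearceRittenbergDeGierNienhuis2002, §2; lane plumbing] -/
private theorem pair_cases {x ja jb c s : Fin (nm + 1 + 1)} (hp : (ja = c ∧ jb = s) ∨ (ja = s ∧ jb = c)) (h : x = c ∨ x = s) : x = ja ∨ x = jb := by
  rcases hp with ⟨rfl, rfl⟩ | ⟨rfl, rfl⟩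
  · exact h
  · exact h.symm

/-- every index of `Fin (k+2)` is `ja`, `jb`, or a skipped one. [cite: PearceRittenbergDeGierNienhuis2002, §2 (link diagrams)] -/
theorem eq_ja_or_jb_or_skip (x : Fin (nm + 1 + 1)) : x = ja ∨ x = jb ∨ ∃ i, x = skip j i := by
  rcases eq_castSucc_or_succ_or_skip j x with h | h | h
  · rcases pair_cases T.pair (Or.inl h) with h' | h'
    · exact Or.inl h'
    · exact Or.inr (Or.inl h')
  · rcases pair_cases T.pair (Or.inr h) with h' | h'
    · exact Or.inl h'
    · exact Or.inr (Or.inl h')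
  · exact Or.inr (Or.inr h)

/-- `skip j i ≠ ja`. [cite: PearceRittenbergDeGierNienhuis2002, §2] -/
theorem skip_ne_ja (i : Fin nm) : skip j i ≠ ja := by
  rcases T.pair with ⟨e, -⟩ | ⟨e, -⟩
  · rw [e]; exact skip_ne_castSucc j i
  · rw [e]; exact skip_ne_succ j i

/-- `skip j i ≠ jb`. [cite: PearceRittenbergDeGierNienhuis2002, §2] -/
theorem skip_ne_jb (i : Fin nm) : skip j i ≠ jb := by
  rcases T.pair with ⟨-, e⟩ | ⟨-, e⟩
  · rw [e]; exact skip_ne_succ j i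
  · rw [e]; exact skip_ne_castSucc j i

/-- `ja ≠ jb`. [cite: PearceRittenbergDeGierNienhuis2002, §2] -/
theorem ja_ne_jb : ja ≠ jb := by
  have hjs : Fin.castSucc j ≠ j.succ := ne_of_lt Fin.castSucc_lt_succ
  rcases T.pair with ⟨e1, e2⟩ | ⟨e1, e2⟩
  · rw [e1, e2]; exact hjs
  · rw [e1, e2]; exact hjs.symm

/-- `{ja, jb} = {j, j+1}`. [cite: PearceRittenbergDeGierNienhuis2002, §2] -/
theorem ja_jb_eq : (ja = Fin.castSucc j ∨ ja = j.succ) ∧ (jb = Fin.castSucc j ∨ jb = j.succ) := by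
  rcases T.pair with ⟨e1, e2⟩ | ⟨e1, e2⟩
  · exact ⟨Or.inl e1, Or.inr e2⟩
  · exact ⟨Or.inr e1, Or.inl e2⟩

/-- `a` does not touch `G`. [cite: BollobasRiordan2006, Ch. 7 §7.2.2 p. 169] -/
theorem a_not_touching : leftFaceDir h₁ (r₁ + k₁) ∉ triFacesTouching D.verts := T.N₁_not_touching T.k₁_lt.le

/-- `b` does not touch `G`. [cite: BollobasRiordan2006, Ch. 7 §7.2.2 p. 169] -/
theorem b_not_touching : leftFaceDir h₂ (r₂ + k₂) ∉ triFacesTouching D.verts := T.N₂_not_touching T.k₂_lt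

/-- `a ≠ b`. [cite: BollobasRiordan2006, Ch. 7 §7.2.2 p. 169] -/
theorem a_ne_b : leftFaceDir h₁ (r₁ + k₁) ≠ leftFaceDir h₂ (r₂ + k₂) := by
  intro e
  rcases (T.N₁_eq_N₂_imp e).1 with e1 | e1
  · exact T.k₁_lt.ne e1
  · exact ((fin6_mA m₁ k₁ T.m₁_le).1 T.k₁_lt.le).1 e1

/-- ★ **the corner faces of `W`**: those of `D`, or `a`, or `b`. [cite: KhristoforovSmirnov2021, §1.2 (arXiv v1 pp. 2–3); BollobasRiordan2006, Ch. 7 §7.2.2 p. 169] -/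
theorem mem_cornersW_iff {F : HexVertex} : F ∈ corners W ↔ F ∈ corners D ∨ F = leftFaceDir h₁ (r₁ + k₁) ∨ F = leftFaceDir h₂ (r₂ + k₂) := by
  rw [mem_corners, mem_corners]
  constructor
  · rintro ⟨x, rfl⟩
    rcases T.eq_ja_or_jb_or_skip x with rfl | rfl | ⟨i, rfl⟩
    · exact Or.inr (Or.inl T.yc_a)
    · exact Or.inr (Or.inr T.yc_b)
    · exact Or.inl ⟨i, T.yc_skip i⟩
  · rintro (⟨i, rfl⟩ | rfl | rfl)
    · exact ⟨skip j i, (T.yc_skip i).symm⟩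
    · exact ⟨ja, T.yc_a.symm⟩
    · exact ⟨jb, T.yc_b.symm⟩

omit T in
/-- a face not touching `G` is not a corner face of `D`. [cite: BollobasRiordan2006, Ch. 7 §7.2.2 p. 169] -/
theorem not_corner_of_not_touching {F : HexVertex} (hF : F ∉ triFacesTouching D.verts) : F ∉ corners D := by
  rw [mem_corners]
  rintro ⟨i, rfl⟩
  exact hF (yc_mem_touching D i)

/-- ★ an outer face `N¹_k`, `k ≤ m₁`, is a corner face of `W` iff `k = k₁`. [cite: BollobasRiordan2006, Ch. 7 §7.2.2 p. 169] -/
theorem N₁_mem_cornersW_iff {k : Fin 6} (hk : k ≤ m₁) : leftFaceDir h₁ (r₁ + k) ∈ corners W ↔ k = k₁ := by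
  rw [T.mem_cornersW_iff]
  constructor
  · rintro (hc | e | e)
    · exact absurd hc (not_corner_of_not_touching (D := D) (T.N₁_not_touching hk))
    · exact N_inj e
    · exfalso
      obtain ⟨-, h4 | h5⟩ := T.N₁_eq_N₂_imp e
      · exact ((fin6_mA m₂ k₂ T.m₂_le).1 T.k₂_lt.le).2.2 h4
      · exact ((fin6_mA m₂ k₂ T.m₂_le).1 T.k₂_lt.le).2.1 h5
  · rintro rfl
    exact Or.inr (Or.inl rfl)

/-- ★ an outer face `N²_k`, `k < m₂`, is a corner face of `W` iff `k = k₂`. [cite: BollobasRiordan2006, Ch. 7 §7.2.2 p. 169] -/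
theorem N₂_mem_cornersW_iff {k : Fin 6} (hk : k < m₂) : leftFaceDir h₂ (r₂ + k) ∈ corners W ↔ k = k₂ := by
  rw [T.mem_cornersW_iff]
  constructor
  · rintro (hc | e | e)
    · exact absurd hc (not_corner_of_not_touching (D := D) (T.N₂_not_touching hk))
    · exfalso
      obtain ⟨h1 | h1, -⟩ := T.N₁_eq_N₂_imp e.symm
      · exact T.k₁_lt.ne h1
      · exact ((fin6_mA m₁ k₁ T.m₁_le).1 T.k₁_lt.le).1 h1
    · exact N_inj e
  · rintro rfl
    exact Or.inr (Or.inr rfl)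

/-- the faces touching `G` that are corner faces of `W` are the corner faces of `D`. [cite: BollobasRiordan2006, Ch. 7 §7.2.2 p. 169] -/
theorem mem_cornersW_iff_of_touching {F : HexVertex} (hF : F ∈ triFacesTouching D.verts) : F ∈ corners W ↔ F ∈ corners D := by
  rw [T.mem_cornersW_iff]
  constructor
  · rintro (hc | rfl | rfl)
    · exact hc
    · exact absurd hF T.a_not_touching
    · exact absurd hF T.b_not_touching
  · exact Or.inl

/-! ## §3 The parity walk of a configuration of `W` -/

omit T in
/-- propositional bookkeeping at the three-valent junction. [cite: KhristoforovSmirnov2021, §1.2 (arXiv v1 p. 2); lane plumbing] -/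
private theorem prop_junction {A B X M C S : Prop} (hM : ¬ M) (hC : ¬ C) (hS : ¬ S)
    (h : ¬ (A ↔ ¬ (B ↔ (X ↔ M))) ↔ (C ∧ ¬ S ∨ S ∧ ¬ C)) : A ↔ (X ↔ B) := by
  tauto

/-- ★★ **THE PARITY WALK ALONG `h₁`**: in a configuration of `W` (at an edge `z`, odd face `s` touching `G`) the new bonds `nb¹_k`, `k ≤ m₁`, are present according to
`nb¹_k ∈ ζ ↔ (nb¹_0 ∈ ζ ↔ k ≤ k₁)` — constant except for ONE flip at the corner `a = N¹_{k₁}`.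
[cite: KhristoforovSmirnov2021, §1.2 (arXiv v1 pp. 2–3: loop configurations with prescribed disorders)] -/
theorem nbond₁_mem_iff {v : HexVertex} {i : Fin 3} {s : HexVertex} (hs : s ∈ triFacesTouching D.verts) {ζ : Finset (Sym2 (Site 2))}
    (hζ : ζ ∈ TXb W v i s) {k : Fin 6} (hk : k ≤ m₁) : nbond h₁ (r₁ + k) ∈ ζ ↔ (nbond h₁ r₁ ∈ ζ ↔ k ≤ k₁) := by
  obtain ⟨hsub, hpar⟩ := (mem_TXb_iff (D := W) v i s ζ).1 hζ
  have hsub' : ζ ⊆ hBonds W := fun b hb => (Finset.mem_erase.1 (hsub hb)).2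
  refine nbond_mem_iff_of_step (fun k hk' => ?_) hk
  have hp := hpar (leftFaceDir h₁ (r₁ + k)) (T.N₁_touchingW k)
  rw [odd_xiDeg_iff_not_iff (leftFaceIdx (r₁ + k)) (fun hm => T.outer₁_not_mem_hBondsW hk' (by rw [← side_N_idx]; exact hsub' hm)), side_N_idx_add_one,
    side_N_idx_add_two, add_assoc r₁ k 1, Finset.mem_symmDiff, Finset.mem_singleton, T.N₁_mem_cornersW_iff hk'.le] at hp
  have hks : leftFaceDir h₁ (r₁ + k) ≠ s := fun e => T.N₁_not_touching hk'.le (e ▸ hs)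
  simpa only [hks, not_false_iff, and_true, false_and, or_false] using hp

/-- ★★ **THE THREE-VALENT OUTER JUNCTION**: in a configuration of `W` the first new bond `nb²_0` at `h₂` is present iff the first new bond `nb¹_0` at `h₁` and the interior bond
`I = nb¹_{m₁+1}` are both present or both absent (the junction `J` is even and its third side is `nb¹_{m₁}`, present iff `nb¹_0` is absent).
[cite: KhristoforovSmirnov2021, §1.2 (arXiv v1 pp. 2–3: loop configurations with prescribed disorders)] -/
theorem nbond₂_zero_mem_iff {v : HexVertex} {i : Fin 3} {s : HexVertex} (hs : s ∈ triFacesTouching D.verts) {ζ : Finset (Sym2 (Site 2))}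
    (hζ : ζ ∈ TXb W v i s) : nbond h₂ r₂ ∈ ζ ↔ (nbond h₁ r₁ ∈ ζ ↔ nbond h₁ (r₁ + (m₁ + 1)) ∈ ζ) := by
  obtain ⟨-, hpar⟩ := (mem_TXb_iff (D := W) v i s ζ).1 hζ
  have hp := hpar (leftFaceDir h₁ (r₁ + m₁)) (T.N₁_touchingW m₁)
  have hJs : leftFaceDir h₁ (r₁ + m₁) ≠ s := fun e => T.N₁_not_touching le_rfl (e ▸ hs)
  have hJc : leftFaceDir h₁ (r₁ + m₁) ∉ corners W := fun hc => T.k₁_lt.ne ((T.N₁_mem_cornersW_iff le_rfl).1 hc).symm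
  have e1 : s(h₁ + triDir (r₁ + m₁), h₁ + triDir (r₁ + m₁ + 1)) = nbond h₂ r₂ := by
    unfold nbond
    rw [← T.o_eq, add_assoc r₁ m₁ 1, ← T.h₂_eq, Sym2.eq_swap]
  rw [Finset.mem_symmDiff, Finset.mem_singleton, odd_xiDeg_iff_three ζ _ (leftFaceIdx (r₁ + m₁)), side_N_idx, side_N_idx_add_one, side_N_idx_add_two, e1, add_assoc r₁ m₁ 1,
    T.nbond₁_mem_iff hs hζ (le_refl m₁)] at hp
  exact prop_junction (not_le.2 T.k₁_lt) hJc hJs hp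

/-- ★★ **THE PARITY WALK ALONG `h₂`**: the new bonds `nb²_k`, `k ≤ m₂`, are present according to `nb²_k ∈ ζ ↔ (nb²_0 ∈ ζ ↔ k ≤ k₂)` — one flip at the corner `b = N²_{k₂}`.
[cite: KhristoforovSmirnov2021, §1.2 (arXiv v1 pp. 2–3: loop configurations with prescribed disorders)] -/
theorem nbond₂_mem_iff {v : HexVertex} {i : Fin 3} {s : HexVertex} (hs : s ∈ triFacesTouching D.verts) {ζ : Finset (Sym2 (Site 2))}
    (hζ : ζ ∈ TXb W v i s) {k : Fin 6} (hk : k ≤ m₂) : nbond h₂ (r₂ + k) ∈ ζ ↔ (nbond h₂ r₂ ∈ ζ ↔ k ≤ k₂) := by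
  obtain ⟨hsub, hpar⟩ := (mem_TXb_iff (D := W) v i s ζ).1 hζ
  have hsub' : ζ ⊆ hBonds W := fun b hb => (Finset.mem_erase.1 (hsub hb)).2
  refine nbond_mem_iff_of_step (fun k hk' => ?_) hk
  have hp := hpar (leftFaceDir h₂ (r₂ + k)) (T.N₂_touchingW k)
  rw [odd_xiDeg_iff_not_iff (leftFaceIdx (r₂ + k)) (fun hm => T.outer₂_not_mem_hBondsW hk' (by rw [← side_N_idx]; exact hsub' hm)), side_N_idx_add_one,
    side_N_idx_add_two, add_assoc r₂ k 1, Finset.mem_symmDiff, Finset.mem_singleton, T.N₂_mem_cornersW_iff hk'] at hp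
  have hks : leftFaceDir h₂ (r₂ + k) ≠ s := fun e => T.N₂_not_touching hk' (e ▸ hs)
  simpa only [hks, not_false_iff, and_true, false_and, or_false] using hp

end TwoCellData

end TwoCell

end Literature.Probability.Percolation.MarkedLoops
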